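import Summits.CriticalPhenomena.CardyFormulaZ2.Theses.CardySelfDualSegment
import Summits.CriticalPhenomena.CardyFormulaZ2.Theorems.CardyMagicRigidityLoopsToCrossingsStubComparisonGeometry
import Summits.CriticalPhenomena.CardyFormulaZ2.Theorems.CardyMagicRigidityLoopsToCrossingsStubCardyContinuity
import Literature.Probability.Percolation.CornerPercolation
import Literature.Probability.Percolation.CardyFormulaConformalInvariance
import Literature.Probability.Percolation.TriCrossingSandwich
import Literature.Probability.LatticeModels.TriangularLatticeProofs
import Literature.Probability.RandomPlanarGeometry.ImageUnivalent
import Literature.Probability.RandomPlanarGeometry.CollarGeometry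
import Literature.Barriers.CriticalPhenomena.EmbeddingModulusUniquenessProofs

/-!
# Crux `SmirnovBasePoint` (stmt-CriticalPhenomena-5474), line `Sketch`: stub `stub_upperQuad`

The UPPER comparison quad `N` of a conformal rectangle `R = (Ω; P₀, P₁, P₂, P₃)`: a conformal
rectangle whose boundary loop is the (re-parametrised) profile loop `u ↦ T.tube (p u) u` of a
two-plateau trapezoid tube profile `p` (`exists_trapezoid_profile`) which is HIGH (`1 + h`, outside
`closure Ω`) along the interiors of the arcs `1, 3` and LOW (`1 - h`, inside `Ω`) along the arcs
`0, 2` and through all four corners. Its marks are shifted so that the arcs `1, 3` of `N` lie on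
the high plateaus (hence at positive distance from `Ω`), the arcs `0, 2` of `N` are close to those
of `R`, the points of `Ω` omitted by `N` are thin caps near `arc 0 ∪ arc 2`, and the points of
`N ∩ Ω` keep a positive distance from `arc 0 ∪ arc 2` (Bollobás–Riordan, *Percolation* (2006),
Ch. 7 p. 186, Fig. 14, with the roles of the two pairs of arcs exchanged; cf.
`OracleSandwich.exists_lowerQuad`).
-/

noncomputable section

namespace Summit.CriticalPhenomena.CardyFormulaZ2.Cruxes.SmirnovBasePoint.ShearedSandwich

open Literature.Probability.RandomPlanarGeometry hiding cardyFunction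
open Literature.Probability.Percolation hiding cardyFunction
open Literature.Probability.LatticeModels
open Literature.Barriers.CriticalPhenomena
open Summit.CriticalPhenomena.CardyFormulaZ2.Cruxes.LoopsToCrossings.OracleSandwich
open Filter Topology Set MeasureTheory Metric

/-- A `1`-periodic function takes the same value at the representative `a + fract (t - a)` of `t`
in the window `[a, a + 1)`. [folklore] -/
theorem apply_window_of_periodic {β : Type*} {f : ℝ → β} (hf : Function.Periodic f 1) (a t : ℝ) :
    f (a + Int.fract (t - a)) = f t := by
  have := hf.sub_int_mul_eq (x := t) ⌊t - a⌋
  rw [mul_one] at this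
  rw [← this, Int.fract]
  congr 1; ring

/-- **Uniform continuity of the boundary loop of a conformal rectangle on the whole line**
(periodicity and uniform continuity on two periods). [folklore] -/
theorem exists_modulus_boundary (R : ConformalRectangle) {ρ : ℝ} (hρ : 0 < ρ) :
    ∃ Δ > 0, ∀ u d : ℝ, |d| < Δ → dist (R.boundary (u + d)) (R.boundary u) < ρ := by
  obtain ⟨Δ, hΔ, hc⟩ := R.exists_dist_boundary_lt hρ
  refine ⟨min Δ 1, lt_min hΔ one_pos, fun u d hd => ?_⟩
  have hd1 : |d| < Δ := hd.trans_le (min_le_left _ _)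
  have hd2 := abs_lt.1 (hd.trans_le (min_le_right _ _))
  have h0 := Int.fract_nonneg (u - R.mark 0)
  have h1 := Int.fract_lt_one (u - R.mark 0)
  have e2 : R.boundary (R.mark 0 + Int.fract (u - R.mark 0) + d) = R.boundary (u + d) := by
    rw [← apply_window_of_periodic R.periodic_boundary (R.mark 0 + d) (u + d), add_sub_add_right_eq_sub]
    congr 1; ring
  rw [← apply_window_of_periodic R.periodic_boundary (R.mark 0) u, ← e2]
  exact hc _ _ ⟨by linarith, by linarith⟩ ⟨by linarith, by linarith⟩ (by rw [add_sub_cancel_left]; exact hd1)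

/-- A boundary point whose parameter is within `e` of the `i`-th arc range is `ρ`-close to the
`i`-th arc, once `e` is below the uniform-continuity modulus of the boundary loop for `ρ`.
[folklore] -/
theorem exists_mem_arc_dist_lt (R : ConformalRectangle) {ρ Δ e : ℝ} (hρ : 0 < ρ)
    (hΔ : ∀ u d : ℝ, |d| < Δ → dist (R.boundary (u + d)) (R.boundary u) < ρ) (he : e < Δ)
    (i : Fin 4) {v : ℝ} (hv1 : R.mark i - e ≤ v) (hv2 : v ≤ R.nextMark i + e) :
    ∃ a ∈ R.arc i, dist (R.boundary v) a < ρ := by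
  rcases lt_or_ge v (R.mark i) with h1 | h1
  · refine ⟨R.boundary (R.mark i), ⟨R.mark i, ⟨le_rfl, (R.mark_lt_nextMark i).le⟩, rfl⟩, ?_⟩
    have := hΔ v (R.mark i - v) (by rw [abs_of_pos (by linarith)]; linarith)
    rw [add_sub_cancel] at this
    rw [dist_comm]; exact this
  rcases le_or_gt v (R.nextMark i) with h2 | h2
  · exact ⟨R.boundary v, ⟨v, ⟨h1, h2⟩, rfl⟩, by rw [dist_self]; exact hρ⟩
  · refine ⟨R.boundary (R.nextMark i), ⟨R.nextMark i, ⟨(R.mark_lt_nextMark i).le, le_rfl⟩, rfl⟩, ?_⟩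
    have := hΔ v (R.nextMark i - v) (by rw [abs_of_neg (by linarith)]; linarith)
    rw [add_sub_cancel] at this
    rw [dist_comm]; exact this

/-- **Interior points off the centre are interior tube points**: a point of `D` other than the
centre `z₀` of the tube data is `tube σ t` with `0 < σ < 1`. [folklore] -/
theorem exists_eq_tube_of_mem_carrier {D : JordanDomain} (T : D.TubeData) {z : ℂ} (hz : z ∈ D.carrier)
    (hz0 : z ≠ T.z₀) : ∃ σ t, 0 < σ ∧ σ < 1 ∧ z = T.tube σ t := by
  -- adapted from `JordanDomain.TubeData.exists_eq_tube_of_mem_of_mem'` (ProfileCollar.lean)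
  obtain ⟨u, hu, rfl⟩ := T.Ci.bijOn_ball.surjOn hz
  have hu1 : ‖u‖ < 1 := mem_ball_zero_iff.1 hu
  have hu0 : u ≠ 0 := by
    rintro rfl
    exact hz0 T.Ci_zero
  have hn : 0 < ‖u‖ := norm_pos_iff.2 hu0
  set v : ℂ := ((‖u‖⁻¹ : ℝ) : ℂ) * u with hv
  have hv1 : ‖v‖ = 1 := by
    rw [hv, norm_mul, Complex.norm_real, Real.norm_eq_abs, abs_of_pos (inv_pos.2 hn), inv_mul_cancel₀ hn.ne']
  obtain ⟨t, ht⟩ : ∃ t, T.Ci.β t = v := by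
    have hfr : T.Ci.Φ v ∈ frontier D.carrier := T.Ci.apply_mem_frontier hv1
    rw [← D.range_boundary] at hfr
    obtain ⟨t, ht⟩ := hfr
    refine ⟨t, ?_⟩
    have h1 : T.Ci.Φ (T.Ci.β t) = T.Ci.Φ v := by rw [T.Ci.apply_β]; exact ht
    exact T.Ci.injOn (mem_closedBall_zero_iff.2 (T.Ci.norm_β t).le) (mem_closedBall_zero_iff.2 hv1.le) h1
  have hu' : u = ((‖u‖ : ℝ) : ℂ) * T.Ci.β t := by
    rw [ht, hv, ← mul_assoc, ← Complex.ofReal_mul, mul_inv_cancel₀ hn.ne', Complex.ofReal_one, one_mul]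
  exact ⟨‖u‖, t, hn, hu1, by rw [T.tube_of_le_one hu1.le, ← hu']⟩

/-- **Stub C (upper comparison quad).** For every conformal rectangle `R`, closeness budget `ε₀`
and cap width `τ` there is a conformal rectangle `N` whose boundary loop and marks are `ε₀`-close
to those of `R`, whose arcs `1, 3` lie outside `Ω` at distance `≥ r` from it, which omits from
`Ω` only points within `τ` of `arc 0 ∪ arc 2`, whose points in `Ω` are `m`-far from
`arc 0 ∪ arc 2`, and whose arcs `0`, `2` are within `τ` of `arc 0`, `arc 2` (two-plateau tube
profile: low through the corners along the arcs `0, 2`, high along the arcs `1, 3`).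
[cite: BollobasRiordan2006, Ch. 7 Lemma 14 p. 184 and p. 186 (Fig. 14)] -/
theorem stub_upperQuad : ∀ (R : ConformalRectangle) (ε₀ τ : ℝ), 0 < ε₀ → 0 < τ →
    ∃ (N : ConformalRectangle) (r m : ℝ), 0 < r ∧ 0 < m ∧
      (∀ u : ℝ, dist (N.boundary u) (R.boundary u) ≤ ε₀) ∧
      (∀ i : Fin 4, |N.mark i - R.mark i| ≤ ε₀) ∧
      (∀ z ∈ N.arc 1 ∪ N.arc 3, ∀ w ∈ R.carrier, r ≤ dist z w) ∧
      (∀ z ∈ R.carrier, z ∉ N.carrier → infDist z (R.arc 0) ≤ τ ∨ infDist z (R.arc 2) ≤ τ) ∧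
      (∀ z ∈ N.carrier, z ∈ R.carrier → m ≤ infDist z (R.arc 0) ∧ m ≤ infDist z (R.arc 2)) ∧
      (∀ z ∈ N.arc 0, infDist z (R.arc 0) ≤ τ) ∧
      (∀ z ∈ N.arc 2, infDist z (R.arc 2) ≤ τ) := by
  intro R ε₀ τ hε₀ hτ
  obtain ⟨h0, h1, h2, h3, h4⟩ := R.marks_chain
  obtain ⟨n0, -, n2, -⟩ := R.nextMarks_eq
  have hm3 := (R.mark_mem 3).2
  obtain ⟨T⟩ := R.toJordanDomain.nonempty_tubeData
  -- the closeness `ρ` achieved through the uniform continuity of the boundary loop, its modulus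
  obtain ⟨ρ, hρ, hρε, hρτ⟩ : ∃ ρ : ℝ, 0 < ρ ∧ 2 * ρ ≤ ε₀ ∧ 2 * ρ ≤ τ :=
    ⟨min ε₀ τ / 2, by positivity, by linarith [min_le_left ε₀ τ], by linarith [min_le_right ε₀ τ]⟩
  obtain ⟨Δ, hΔ0, hΔ⟩ := exists_modulus_boundary R hρ
  -- the room `s`
  obtain ⟨s, hs0, hsε, hsΔ, hs12, hs3⟩ : ∃ s : ℝ, 0 < s ∧ 8 * s ≤ ε₀ ∧ 8 * s ≤ Δ ∧
      8 * s ≤ R.mark 2 - R.mark 1 ∧ 8 * s ≤ 1 - R.mark 3 := by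
    have a1 := min_le_left (min ε₀ Δ) (min (R.mark 2 - R.mark 1) (1 - R.mark 3))
    have a2 := min_le_right (min ε₀ Δ) (min (R.mark 2 - R.mark 1) (1 - R.mark 3))
    have b1 := min_le_left ε₀ Δ
    have b2 := min_le_right ε₀ Δ
    have b3 := min_le_left (R.mark 2 - R.mark 1) (1 - R.mark 3)
    have b4 := min_le_right (R.mark 2 - R.mark 1) (1 - R.mark 3)
    have hM0 : 0 < min (min ε₀ Δ) (min (R.mark 2 - R.mark 1) (1 - R.mark 3)) :=
      lt_min (lt_min hε₀ hΔ0) (lt_min (by linarith) (by linarith))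
    exact ⟨min (min ε₀ Δ) (min (R.mark 2 - R.mark 1) (1 - R.mark 3)) / 8, by positivity,
      by linarith, by linarith, by linarith, by linarith⟩
  -- separation of the non-low boundary points from the arcs `0, 2` (via the re-marked rectangle)
  obtain ⟨R₁, -, hR₁b, hR₁m, -, a1, -, a3⟩ := R.exists_shiftMarks
  have r0 : R₁.mark 0 = 0 := hR₁m 0
  have r1 : R₁.mark 1 = R.mark 2 - R.mark 1 := hR₁m 1
  have r2 : R₁.mark 2 = R.mark 3 - R.mark 1 := hR₁m 2
  have r3 : R₁.mark 3 = R.mark 0 + 1 - R.mark 1 := hR₁m 3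
  obtain ⟨d₀, hd₀, hsep⟩ := R₁.exists_sep_arcs (κ := s / 8) (by positivity)
  -- the tube tolerance and the width `h`
  have hdepth := R.toJordanDomain.infDist_frontier_pos T.hz₀
  obtain ⟨tol, htol0, htolε, htolτ, htolz, htold⟩ : ∃ tol : ℝ, 0 < tol ∧ 2 * tol ≤ ε₀ ∧ 2 * tol ≤ τ ∧
      tol ≤ infDist T.z₀ (frontier R.carrier) ∧ 4 * tol ≤ d₀ := by
    have a1 := min_le_left (min (ε₀ / 2) (τ / 2)) (min (infDist T.z₀ (frontier R.carrier)) (d₀ / 4))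
    have a2 := min_le_right (min (ε₀ / 2) (τ / 2)) (min (infDist T.z₀ (frontier R.carrier)) (d₀ / 4))
    have b1 := min_le_left (ε₀ / 2) (τ / 2)
    have b2 := min_le_right (ε₀ / 2) (τ / 2)
    have b3 := min_le_left (infDist T.z₀ (frontier R.carrier)) (d₀ / 4)
    have b4 := min_le_right (infDist T.z₀ (frontier R.carrier)) (d₀ / 4)
    exact ⟨min (min (ε₀ / 2) (τ / 2)) (min (infDist T.z₀ (frontier R.carrier)) (d₀ / 4)),
      lt_min (lt_min (by linarith) (by linarith)) (lt_min hdepth (by linarith)),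
      by linarith, by linarith, by linarith, by linarith⟩
  obtain ⟨h, hh, hh1, htol⟩ := T.exists_dist_tube_lt htol0
  -- the depth of the inner levels, the outer room, the profile (high on the arcs `1, 3`)
  obtain ⟨mi, hmi, hdeep⟩ := T.exists_le_infDist_tube_inner (h := h / 2) (by linarith) (by linarith)
  obtain ⟨mo, hmo, hout⟩ := T.exists_le_infDist_tube_outer (h := h) hh hh1
  obtain ⟨p, hpc, hper, hband, hplat, hloc⟩ := exists_trapezoid_profile (a₀ := R.mark 1) (a₁ := R.mark 2)
    (a₂ := R.mark 3) (a₃ := R.mark 0 + 1) (s := s) (h := h) (θ := h) (by linarith) h3.le (by linarith)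
    (by linarith) hs0 hh hh le_rfl
  have hp0 : ∀ u, 0 < p u := fun u => by linarith [(hband u).1]
  have hp2 : ∀ u, p u < 2 := fun u => by linarith [(hband u).2]
  have htolp : ∀ u, dist (T.tube (p u) u) (R.boundary u) < tol := fun u => htol _ _ (hband u).1 (hband u).2
  -- the quad: the profile loop re-parametrised by `u ↦ u - 2 s`
  have hLc : Continuous fun u => T.tube (p (u - 2 * s)) (u - 2 * s) :=
    (T.continuous_profileLoop hpc hp0 hp2).comp (continuous_id.sub continuous_const)
  have hLp : Function.Periodic (fun u => T.tube (p (u - 2 * s)) (u - 2 * s)) 1 :=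
    (T.periodic_profileLoop hper).sub_const (2 * s)
  have hLi : InjOn (fun u => T.tube (p (u - 2 * s)) (u - 2 * s)) (Ico 0 1) := fun a ha b hb hab => by
    have := (JordanDomain.ofLoop (T.continuous_profileLoop hpc hp0 hp2) (T.periodic_profileLoop hper)
      (T.injOn_profileLoop hp0 hp2)).injOn_boundary_Ico (-(2 * s))
      (show a - 2 * s ∈ Ico (-(2 * s)) (-(2 * s) + 1) from ⟨by linarith [ha.1], by linarith [ha.2]⟩)
      (show b - 2 * s ∈ Ico (-(2 * s)) (-(2 * s) + 1) from ⟨by linarith [hb.1], by linarith [hb.2]⟩) hab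
    linarith
  let N : ConformalRectangle :=
    { toJordanDomain := JordanDomain.ofLoop hLc hLp hLi
      mark := ![R.mark 0, R.mark 1 + 4 * s, R.mark 2, R.mark 3 + 4 * s]
      strictMono_mark := Fin.strictMono_iff_lt_succ.2 fun k => by
        fin_cases k
        · show R.mark 0 < R.mark 1 + 4 * s; linarith
        · show R.mark 1 + 4 * s < R.mark 2; linarith
        · show R.mark 2 < R.mark 3 + 4 * s; linarith
      mark_mem := fun k => by
        fin_cases k
        · show R.mark 0 ∈ Ico 0 1; exact ⟨h0, by linarith⟩
        · show R.mark 1 + 4 * s ∈ Ico 0 1; exact ⟨by linarith, by linarith⟩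
        · show R.mark 2 ∈ Ico 0 1; exact ⟨by linarith, by linarith⟩
        · show R.mark 3 + 4 * s ∈ Ico 0 1; exact ⟨by linarith, by linarith⟩ }
  have hNf' : frontier N.carrier = range fun u => T.tube (p (u - 2 * s)) (u - 2 * s) :=
    JordanDomain.frontier_ofLoop_carrier _ _ _
  have hNf : frontier N.carrier = range fun u => T.tube (p u) u := by
    rw [hNf']
    ext z
    constructor
    · rintro ⟨u, rfl⟩; exact ⟨u - 2 * s, rfl⟩
    · rintro ⟨v, rfl⟩; exact ⟨v + 2 * s, by simp only [add_sub_cancel_right]⟩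
  obtain ⟨nN0, nN1, nN2, nN3⟩ := N.nextMarks_eq
  -- the centre is inside
  have hz₀N : T.z₀ ∈ N.carrier :=
    T.z₀_mem_of_frontier_eq hpc hper hp0 hp2 N.toJordanDomain hNf fun u => (htolp u).trans_le htolz
  -- the non-low boundary points are `d₀`-far from the arcs `0, 2`
  have hKB : ∀ t, 1 - h / 2 < p t → ∀ b ∈ R.arc 0 ∪ R.arc 2, d₀ ≤ dist (R.boundary t) b := by
    intro t ht b hb
    have e1 : R.boundary t = R₁.boundary (R.mark 1 + Int.fract (t - R.mark 1) - R.mark 1) := by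
      rw [hR₁b, sub_add_cancel, apply_window_of_periodic R.periodic_boundary]
    rw [e1]
    refine hsep _ ?_ b ?_
    · rcases hloc t ht with ⟨ha, hb'⟩ | ⟨ha, hb'⟩
      · left; rw [r0, r1]; exact ⟨by linarith, by linarith⟩
      · right; rw [r2, r3]; exact ⟨by linarith, by linarith⟩
    · rcases hb with hb | hb
      · right; rw [a3]; exact hb
      · left; rw [a1]; exact hb
  have hBfr : R.arc 0 ∪ R.arc 2 ⊆ frontier R.carrier :=
    union_subset (R.arc_subset_frontier 0) (R.arc_subset_frontier 2)
  -- a tube point of the band over a parameter `ρ`-close to an arc is within `τ` of it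
  have hnear : ∀ (σ v : ℝ) (A : Set ℂ), 1 - h ≤ σ → σ ≤ 1 + h → (∃ a ∈ A, dist (R.boundary v) a < ρ) →
      infDist (T.tube σ v) A ≤ τ := fun σ v A hσ1 hσ2 ⟨a, ha, hva⟩ =>
    (infDist_le_dist_of_mem ha).trans (by
      linarith [dist_triangle (T.tube σ v) (R.boundary v) a, htol σ v hσ1 hσ2])
  refine ⟨N, mo, min mi (d₀ / 2), hmo, lt_min hmi (by linarith), fun u => ?_, fun i => ?_,
    fun z hz w hw => ?_, fun z hzΩ hzN => ?_, fun z hzN hzΩ => ?_, ?_, ?_⟩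
  · -- closeness of the boundary loops
    show dist (T.tube (p (u - 2 * s)) (u - 2 * s)) (R.boundary u) ≤ ε₀
    have e1 := htolp (u - 2 * s)
    have e2 := hΔ u (-(2 * s)) (by rw [abs_neg, abs_of_pos (by positivity)]; linarith)
    rw [← sub_eq_add_neg] at e2
    linarith [dist_triangle (T.tube (p (u - 2 * s)) (u - 2 * s)) (R.boundary (u - 2 * s)) (R.boundary u)]
  · -- closeness of the marks
    fin_cases i
    · show |R.mark 0 - R.mark 0| ≤ ε₀; rw [sub_self, abs_zero]; exact hε₀.le
    · show |R.mark 1 + 4 * s - R.mark 1| ≤ ε₀; rw [add_sub_cancel_left, abs_of_pos (by positivity)]; linarith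
    · show |R.mark 2 - R.mark 2| ≤ ε₀; rw [sub_self, abs_zero]; exact hε₀.le
    · show |R.mark 3 + 4 * s - R.mark 3| ≤ ε₀; rw [add_sub_cancel_left, abs_of_pos (by positivity)]; linarith
  · -- the arcs `1, 3` of `N` lie on the high plateau, `mo`-far from `Ω`
    have hfar : ∀ v, mo ≤ dist (T.tube (1 + h) v) w := fun v =>
      (hout _ v le_rfl (by linarith)).trans (infDist_le_dist_of_mem (subset_closure hw))
    rcases hz with ⟨u, hu, rfl⟩ | ⟨u, hu, rfl⟩
    · rw [nN1] at hu
      change u ∈ Icc (R.mark 1 + 4 * s) (R.mark 2) at hu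
      show mo ≤ dist (T.tube (p (u - 2 * s)) (u - 2 * s)) w
      rw [hplat (u - 2 * s) (Or.inl ⟨by linarith [hu.1], by linarith [hu.2]⟩)]
      exact hfar _
    · rw [nN3] at hu
      change u ∈ Icc (R.mark 3 + 4 * s) (R.mark 0 + 1) at hu
      show mo ≤ dist (T.tube (p (u - 2 * s)) (u - 2 * s)) w
      rw [hplat (u - 2 * s) (Or.inr ⟨by linarith [hu.1], by linarith [hu.2]⟩)]
      exact hfar _
  · -- thin caps: a point of `Ω` off `N` is a shallow tube point over a low parameter
    have hz0 : z ≠ T.z₀ := fun e => hzN (e ▸ hz₀N)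
    obtain ⟨σ, t, hσ0, hσ1, rfl⟩ := exists_eq_tube_of_mem_carrier T hzΩ hz0
    have hpt : p t ≤ σ := not_lt.1 fun hlt =>
      hzN (T.tube_mem_of_frontier_eq hper hp0 hp2 N.toJordanDomain hNf hz₀N hσ0.le hlt)
    have hσ : 1 - h ≤ σ := ((hband t).1).trans hpt
    -- the window representative of `t` is off the high plateaus
    set w := R.mark 1 + Int.fract (t - R.mark 1) with hw
    have hw0 : R.mark 1 ≤ w := by have := Int.fract_nonneg (t - R.mark 1); rw [hw]; linarith
    have hw1 : w < R.mark 1 + 1 := by have := Int.fract_lt_one (t - R.mark 1); rw [hw]; linarith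
    have hpw : p w < 1 + h := by rw [hw, apply_window_of_periodic hper]; linarith
    have hbw : R.boundary w = R.boundary t := apply_window_of_periodic R.periodic_boundary _ _
    rcases lt_or_ge w (R.mark 1 + s / 2) with c1 | c1
    · refine Or.inl (hnear σ t _ hσ (by linarith) ?_)
      rw [← hbw]
      exact exists_mem_arc_dist_lt R hρ hΔ (e := s / 2) (by linarith) 0 (by linarith) (by rw [n0]; linarith)
    rcases le_or_gt w (R.mark 2 - s / 2) with c2 | c2
    · exact absurd (hplat w (Or.inl ⟨c1, c2⟩)) hpw.ne
    rcases lt_or_ge w (R.mark 3 + s / 2) with c3 | c3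
    · refine Or.inr (hnear σ t _ hσ (by linarith) ?_)
      rw [← hbw]
      exact exists_mem_arc_dist_lt R hρ hΔ (e := s / 2) (by linarith) 2 (by linarith) (by rw [n2]; linarith)
    rcases le_or_gt w (R.mark 0 + 1 - s / 2) with c4 | c4
    · exact absurd (hplat w (Or.inr ⟨c3, c4⟩)) hpw.ne
    · refine Or.inl (hnear σ t _ hσ (by linarith) ?_)
      rw [← hbw, ← R.periodic_boundary.sub_eq w]
      exact exists_mem_arc_dist_lt R hρ hΔ (e := s / 2) (by linarith) 0 (by linarith) (by rw [n0]; linarith)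
  · -- points of `N ∩ Ω` are deep, or shallow over a non-low parameter: far from the arcs `0, 2`
    obtain ⟨σ, t, hσ0, hσ1, hσp, rfl⟩ := T.exists_eq_tube_of_mem_of_mem'' hper hp0 hp2 N.toJordanDomain hNf hzN hzΩ
    have key : ∀ b ∈ R.arc 0 ∪ R.arc 2, min mi (d₀ / 2) ≤ dist (T.tube σ t) b := fun b hb => by
      rcases le_or_gt σ (1 - h / 2) with hd | hsh
      · exact (min_le_left _ _).trans ((hdeep σ t (abs_le.2 ⟨by linarith, hd⟩)).trans
          (infDist_le_dist_of_mem (hBfr hb)))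
      · have e1 := hKB t (by linarith) b hb
        have e2 := htol σ t (by linarith) (by linarith)
        rw [dist_comm] at e2
        exact (min_le_right _ _).trans (by linarith [dist_triangle (R.boundary t) (T.tube σ t) b])
    exact ⟨(le_infDist ⟨R.pt 0, R.pt_mem_arc_self 0⟩).2 fun b hb => key b (Or.inl hb),
      (le_infDist ⟨R.pt 2, R.pt_mem_arc_self 2⟩).2 fun b hb => key b (Or.inr hb)⟩
  · -- the arc `0` of `N` is within `τ` of `arc 0`
    rintro _ ⟨u, hu, rfl⟩
    rw [nN0] at hu
    change u ∈ Icc (R.mark 0) (R.mark 1 + 4 * s) at hu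
    show infDist (T.tube (p (u - 2 * s)) (u - 2 * s)) (R.arc 0) ≤ τ
    exact hnear _ _ _ (hband _).1 (hband _).2
      (exists_mem_arc_dist_lt R hρ hΔ (e := 2 * s) (by linarith) 0 (by linarith [hu.1]) (by rw [n0]; linarith [hu.2]))
  · -- the arc `2` of `N` is within `τ` of `arc 2`
    rintro _ ⟨u, hu, rfl⟩
    rw [nN2] at hu
    change u ∈ Icc (R.mark 2) (R.mark 3 + 4 * s) at hu
    show infDist (T.tube (p (u - 2 * s)) (u - 2 * s)) (R.arc 2) ≤ τ
    exact hnear _ _ _ (hband _).1 (hband _).2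
      (exists_mem_arc_dist_lt R hρ hΔ (e := 2 * s) (by linarith) 2 (by linarith [hu.1]) (by rw [n2]; linarith [hu.2]))

end Summit.CriticalPhenomena.CardyFormulaZ2.Cruxes.SmirnovBasePoint.ShearedSandwich
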